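import Summits.HodgeConjecture.CorCM.IrreducibleOddWeightsOrbitBalanceHodge
import Summits.HodgeConjecture.CorCM.IrreducibleOddWeightsOrbitBalanceQuadratic
import Literature.AlgebraicGeometry.Pohlmann1968.SimpleCMAbelianFourfoldHodgeConjecture
import HarnessLib

/-!
# ORBIT BALANCE × Markman: the Hodge conjecture on every `A^a × B^b` for a SIMPLE CM abelian FOURFOLD `A` equidistributed
# over a normal subfield `M ⊆ K_A` of degree `≤ 6` and any `B` with CM by `M` — granted Markman's theorem on Weil classes

COR-CM (cell `pub-hodgecm2`, binder seat `b16` gen 62, count-neutral claim ORBIT BALANCE, file O9 — realisations; theorems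
only, no definition, no NEW named fact, no `sorry`).  NEW as stated, hence under `Summits/`.  HONEST FRAMING: a CONDITIONAL
instance family of the Hodge conjecture — conditional ONLY on the tree's named fact
`HodgeTheory.Markman2025_weilClasses_algebraic_abelianFourfold` (Markman 2025), taken as an explicit hypothesis `hM` exactly as
in the tree's `…OfMarkman` files; `HC_CM` is neither used nor asserted.

INPUT.  (a) The tree's `Pohlmann1968.hodgeConjectureFor_powSucc_of_dim_four_of_markman`: granted Markman's theorem, every
POWER of a SIMPLE complex abelian fourfold of CM type satisfies the Hodge conjecture.  (b) File O4
`hodgeConjectureFor_biproduct_pair_of_shadow_eq_zero_of_powSucc` / file O5: if `K_{i₁}` is normal of degree `≤ 6`, embedded in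
`K_{i₀}` by `j`, and `Φ_{i₀}` is EQUIDISTRIBUTED over it, the Hodge conjecture on every `A₀^a × A₁^b` follows from the Hodge
conjecture for the powers of `A₀` alone.  Hence:

* **`hodgeConjectureFor_biproduct_fourfold_pair_of_shadow_eq_zero_of_markman`** — `A₀` a SIMPLE CM abelian fourfold
  (`[K_{i₀}:ℚ] = 8`), `K_{i₁}` normal of degree `≤ 6` with `j : K_{i₁} → K_{i₀}` and `Φ_{i₀}` equidistributed over `j(K_{i₁})`
  (so `K_{i₁}` is an imaginary quadratic `k` with `Φ_{i₀}` of signature `(2,2)` over `k` — `A₀` of WEIL TYPE — or a quartic CM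
  field with `Φ_{i₀}` of pattern `(1,1)` at each of its places), `A₁` ANY realisation of any type of `K_{i₁}` (a CM elliptic
  curve `E_k`, a CM abelian surface): granted Markman, the Hodge conjecture holds on EVERY `⨁_l A_{π l}` — all
  `A₀^a × A₁^b`, of dimension `4a + b·[K_{i₁}:ℚ]/2`, i.e. BEYOND the tree's dimension-`≤ 5` theorem
  `hodgeConjectureFor_of_isOfCMType_dim_le_five_of_markman` as soon as `4a + b ≥ 6`;
* **`hodgeConjectureFor_biproduct_weilFourfold_ellipticCurve_of_markman`** — the `k`-signature form: `[K_{i₁}:ℚ] = 2`,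
  defect `Σ_{φ ∈ Φ_{i₀}} sign(φ|_k) = 0`.
Unconditionally (files O4/O5): on these products every Hodge class is a sum of products of Hodge classes of `A₀^a` and of
`A₁^b`; Markman's theorem (through (a)) makes those algebraic.

## References

* [Markman2025SurveySecant] E. Markman (2025), Thm. 1.2, §1.1, §11.5 Step 2; [Markman2025SecantWeil] Cor. 1.6.1.
* [MoonenZarhin1999LowDim] B. Moonen, Yu. Zarhin, Math. Ann. 315 (1999), Thm. (0.1), §3 (3.1), §5 (5.2).
* [MoonenZarhin1995Duke] B. Moonen, Yu. Zarhin, Duke Math. J. 77 (1995), Thm. 2.4 (simple abelian fourfolds).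
* [Gordon1999HodgeAVSurvey] B. B. Gordon, *A survey of the Hodge conjecture for abelian varieties*, §10.12.2, 7.5–7.7, 9.4.3.
* [vanGeemen1994HodgeAV] B. van Geemen, LNM 1594 (1994), §3.5–3.7 Lemma 3.7, Thm. 6.12.
-/

set_option autoImplicit false

noncomputable section

open scoped BigOperators Classical

open CategoryTheory CategoryTheory.Limits NumberField Module

namespace Summit.HodgeConjecture.CorCM

open Literature.NumberTheory.ComplexMultiplication
open Literature.AlgebraicGeometry.Motives (AbelianVariety CMType)
open Literature.AlgebraicGeometry.Motives.AbelianVariety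
open Literature.AlgebraicGeometry.HodgeTheory
open Literature.AlgebraicGeometry.ComplexMultiplication (IsCMTypeRealisation)
open Literature.AlgebraicGeometry.Pohlmann1968

variable {I : Type} [Fintype I] {K : I → Type} [∀ i, Field (K i)] [∀ i, NumberField (K i)] [∀ i, IsCMField (K i)]
  {Φ : ∀ i, CMType (K i)} {A : I → AbelianVariety ℂ} {ιA : ∀ i, 𝓞 (K i) →+* End (A i)}
  {θ : ∀ i, K i →+* Module.End ℂ (complexBetti (A i).X 1)}

/-- **GRANTED MARKMAN: the Hodge conjecture on every `A₀^a × A₁^b` for a SIMPLE CM abelian fourfold `A₀` whose type is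
equidistributed over a normal subfield `K_{i₁} ↪ K_{i₀}` of degree `≤ 6`, and ANY `A₁` with CM by `K_{i₁}`.**  The powers of
`A₀` are Hodge by Markman (tree `hodgeConjectureFor_powSucc_of_dim_four_of_markman`), the pair has `Hg(A₀ × A₁) = Hg(A₀) × Hg(A₁)`
(file O3), and the powers of `A₁` (dimension `≤ 3`) are divisor-generated.  CONDITIONAL on Markman's theorem only.
[cite: Markman2025SurveySecant, Thm. 1.2 and §11.5 Step 2] [cite: MoonenZarhin1999LowDim, §3 (3.1) and §5 (5.2)]
[cite: Gordon1999HodgeAVSurvey, §10.12.2 and 9.4.3] -/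
theorem hodgeConjectureFor_biproduct_fourfold_pair_of_shadow_eq_zero_of_markman
    (hM : Markman2025_weilClasses_algebraic_abelianFourfold) {i₀ i₁ : I} (h01 : i₀ ≠ i₁) (hI : ∀ l, l = i₀ ∨ l = i₁)
    [Normal ℚ (K i₁)] (h8 : finrank ℚ (K i₀) = 8) (h6 : finrank ℚ (K i₁) ≤ 6) (j : K i₁ →+* K i₀)
    (hbal : ∀ z : K i₁ →+* ℂ, 2 * (Finset.univ.filter fun t : K i₀ →+* ℂ => t.comp j = z ∧ t ∈ (Φ i₀).1).card =
      (Finset.univ.filter fun t : K i₀ →+* ℂ => t.comp j = z).card)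
    (hA : ∀ i, IsCMTypeRealisation (Φ i) (A i) (ιA i) (θ i)) (hs : (A i₀).IsSimple)
    {J : Type} [Fintype J] [Nonempty J] (π : J → I) :
    HodgeConjectureFor (⨁ fun l => A (π l)).dim (⨁ fun l => A (π l)).X := by
  have hdim' : (A i₀).dim = finrank ℚ (K i₀) / 2 := Literature.AlgebraicGeometry.Motives.schemeDim_eq_holds (hA i₀).1
  have hdim : (A i₀).dim = 4 := by rw [hdim', h8]
  exact hodgeConjectureFor_biproduct_pair_of_shadow_eq_zero_of_powSucc h01 hI h6 j hbal hA
    (fun N => hodgeConjectureFor_powSucc_of_dim_four_of_markman hM hs hdim (hA i₀).isOfCMType N) π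

/-- **GRANTED MARKMAN: the Hodge conjecture on every `A^a × E_k^b` for a simple CM abelian fourfold `A` of WEIL TYPE
relative to `k ⊆ K_A`** (`[K_{i₁}:ℚ] = 2`, `j : K_{i₁} → K_{i₀}`, signature defect `Σ_{φ ∈ Φ_{i₀}} sign(φ|_k) = 0`, i.e.
signature `(2,2)` over `k`) and the CM elliptic curve `A_{i₁} = E_k`; dimension `4a + b` unbounded.  CONDITIONAL on Markman's
theorem only. [cite: Markman2025SurveySecant, Thm. 1.2 and §11.5 Step 2] [cite: MoonenZarhin1999LowDim, Thm. (0.1) (a) and §3 (3.1)]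
[cite: Deligne1982HodgeCycles, §4] -/
theorem hodgeConjectureFor_biproduct_weilFourfold_ellipticCurve_of_markman
    (hM : Markman2025_weilClasses_algebraic_abelianFourfold) {i₀ i₁ : I} (h01 : i₀ ≠ i₁) (hI : ∀ l, l = i₀ ∨ l = i₁)
    (h8 : finrank ℚ (K i₀) = 8) (hk : finrank ℚ (K i₁) = 2) (j : K i₁ →+* K i₀) (ι₀ : K i₁ →+* ℂ)
    (hd : ∑ φ ∈ Finset.univ.filter (fun φ : K i₀ →+* ℂ => φ ∈ (Φ i₀).1), (if φ.comp j = ι₀ then (1 : ℚ) else -1) = 0)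
    (hA : ∀ i, IsCMTypeRealisation (Φ i) (A i) (ιA i) (θ i)) (hs : (A i₀).IsSimple)
    {J : Type} [Fintype J] [Nonempty J] (π : J → I) :
    HodgeConjectureFor (⨁ fun l => A (π l)).dim (⨁ fun l => A (π l)).X := by
  have hdim' : (A i₀).dim = finrank ℚ (K i₀) / 2 := Literature.AlgebraicGeometry.Motives.schemeDim_eq_holds (hA i₀).1
  have hdim : (A i₀).dim = 4 := by rw [hdim', h8]
  exact hodgeConjectureFor_biproduct_pair_of_sum_ksign_eq_zero_of_powSucc h01 hI hk j ι₀ hd hA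
    (fun N => hodgeConjectureFor_powSucc_of_dim_four_of_markman hM hs hdim (hA i₀).isOfCMType N) π

/-- **UNCONDITIONAL part of the same configuration** (no Markman): every rational Hodge class on every `A^a × E_k^b` for a
CM abelian variety `A` of Weil type relative to `k` (any dimension, simple or not) is a sum of exterior products of Hodge
classes of `A^a` and of `E_k^b` (file O5) — recorded here next to its conditional sharpening.
[cite: MoonenZarhin1999LowDim, §3 (3.1)] [cite: Deligne1982HodgeCycles, §4] -/
theorem hodgeClassesProductSpan_biproduct_weil_ellipticCurve {J₁ J₂ : Type} [Fintype J₁] [Fintype J₂] [Nonempty J₁]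
    [Nonempty J₂] {i₀ i₁ : I} (h01 : i₀ ≠ i₁) (hI : ∀ l, l = i₀ ∨ l = i₁) (hk : finrank ℚ (K i₁) = 2) (j : K i₁ →+* K i₀)
    (ι₀ : K i₁ →+* ℂ)
    (hd : ∑ φ ∈ Finset.univ.filter (fun φ : K i₀ →+* ℂ => φ ∈ (Φ i₀).1), (if φ.comp j = ι₀ then (1 : ℚ) else -1) = 0)
    (hA : ∀ i, IsCMTypeRealisation (Φ i) (A i) (ιA i) (θ i)) (π₁ : J₁ → I) (π₂ : J₂ → I)
    (hdisj : ∀ j₁ j₂, π₁ j₁ ≠ π₂ j₂) :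
    HodgeClassesProductSpan (⨁ fun l => A (π₁ l)) (⨁ fun l => A (π₂ l)) :=
  hodgeClassesProductSpan_biproduct_of_cmFamilyRank_add_card_eq
    (cmFamilyRank_add_card_eq_pair_of_sum_ksign_eq_zero h01 hI hk j ι₀ Φ hd) hA π₁ π₂ hdisj

end Summit.HodgeConjecture.CorCM

end
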